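import Mathlib
import HarnessLib
import Summits.HubbardSuperconductivity.HubbardSuperconductivity.Theorems.KLProgrammeKLRegimeEngineTowerRemeasureNarrowWideSplitRows
import Summits.HubbardSuperconductivity.HubbardSuperconductivity.Theorems.KLProgrammeKLRegimeEngineTowerRemeasureNarrowWideSplitUniform

/-!
# Route `KLProgramme` — crux K3 ENGINE (stmt-HubbardSuperconductivity-20437 `KLRegimeEngineV17F2`), stub (b) v2, THE LEVELS PACKAGE (ℓ), instantiation (I2):
# THE INCREMENT RE-MEASURED WITH THE NARROW / WIDE SPLIT, m-UNIFORM CONSTANTS («(I2)-CONST-UNIFORM» U7, prep for the `F = 1` track of «(I2)-KIT-HMU-LEV»;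
# cell gate-hubbard-kl, seat p4 g17)

Twin of `klLevNormOf_klTowerIncr_narrowWideSplit_le_klEng (m) (hm)` (k3c2-p3, …NarrowWideSplitRows) on `klLevNormOf_jump_le_narrowWideSplit_klEng_uniform` (U6): every
constant and threshold BEFORE `m`; jump constant `C₀^{m+1}`, on-class count constant `(D₂ + 1)(m + 2)³`.

* **`klLevNormOf_klTowerIncr_narrowWideSplit_le_klEng_uniform`**.
Composition of landed theorems; nothing about the model is asserted beyond them; nothing asserts (ℓ), any stub, K3 or superconductivity.
References: BGM 2006 §2.8 (2.82)–(2.84), (2.88)–(2.90), App. A3 [cite: BenfattoGiulianiMastropietro2006].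
-/

noncomputable section

namespace Summit.HubbardSuperconductivity.HubbardSuperconductivity.Theorems.EngineV8

set_option linter.dupNamespace false -- summit = problem name (single-conjunct summit), D-0017

open Classical
open Real Finset Literature.MathematicalPhysics.QuantumLattice Literature.Probability.LatticeModels GrassmannAlgebra
open Literature.MathematicalPhysics.QuantumLattice.FermiRG
open Summit.HubbardSuperconductivity.HubbardSuperconductivity.Theorems.KLRegimeSplit
open Summit.HubbardSuperconductivity.HubbardSuperconductivity.Theorems.KLProgrammeLegKernels
open Summit.HubbardSuperconductivity.HubbardSuperconductivity.Theorems.DispersionFlow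
open Summit.HubbardSuperconductivity.HubbardSuperconductivity.Theorems.PerturbedFermiCurve

variable {L M : ℕ} [NeZero L] [NeZero M]

/-- **THE INCREMENT `Δ_{k′}` RE-MEASURED AT `F_{dk−1}`, NARROW / WIDE SPLIT, ON E1's ARRAYS — m-UNIFORM CONSTANTS** (`m + 1 ≥ 4` legs; twin of
`klLevNormOf_klTowerIncr_narrowWideSplit_le_klEng`). [cite: BenfattoGiulianiMastropietro2006, §2.8 (2.82)-(2.84), (2.88)-(2.90), App. A3] -/
theorem klLevNormOf_klTowerIncr_narrowWideSplit_le_klEng_uniform :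
    ∃ C₀ : ℝ, 0 < C₀ ∧ ∃ C : ℝ, 0 < C ∧ ∃ D₁ : ℝ, 0 < D₁ ∧ ∃ Cw : ℝ, 0 < Cw ∧
      ∃ c₂ cb K₁ K₂ c₀ c₂' : ℝ, 0 ≤ c₂ ∧ 0 < cb ∧ 2 + c₂ ≤ K₁ ∧ 0 < K₂ ∧ 0 < c₀ ∧ 0 < c₂' ∧
      ∃ D₂ : ℝ, 0 < D₂ ∧ ∃ k₀ : ℕ,
      ∀ R : RenConsts, R.WF2 → ∃ c₃ : ℝ, 0 < c₃ ∧ ∃ U₀ : ℝ, 0 < U₀ ∧ ∃ Λ : ℝ, 0 ≤ Λ ∧ ∃ r₀ : ℝ, 0 < r₀ ∧ ∃ v₀ : ℝ, 0 < v₀ ∧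
      ∀ m : ℕ, 3 ≤ m →
      ∀ (P : SplitConsts) (c : ℝ), P.WF → 0 < c → c ≤ klEngC₃6 P R → c ≤ c₃ →
      ∀ μ ∈ klWindowC, ∀ U : ℝ, 0 < U → U ≤ klEngU₀9 P R c → U ≤ U₀ → ∀ β : ℝ, klBetaMin ≤ β → β ≤ Real.exp (c / U ^ 2) →
      ∀ K : TrigPolyC4v, FrameOK R U (nScales β) μ K → ∀ (L M : ℕ) [NeZero L] [NeZero M],
      klEngL₃ β U ≤ L → klEngM₃ β U L ≤ M → ∀ d k k' : ℕ, 2 ≤ d → k' < k → k₀ ≤ d * k' → d * k - 1 ≤ nScales β + 1 →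
      ∀ (Θ LΨ Bfib : ℝ), LΨ = (m + 1 : ℕ) + c₂ * (π / 2 + 5 * sectorWidth (d * k')) / (K₁ * Θ) → (2 : ℝ) ^ (-((d * k - 1 : ℕ) : ℤ)) ≤ Θ →
        cb * (2 : ℝ) ^ (-((d * k - 1 : ℕ) : ℤ)) ≤ Θ → K₂ * LΨ * (cb * (2 : ℝ) ^ (-((d * k - 1 : ℕ) : ℤ))) ≤ c₂' * Θ →
        max ((2 * ((2 * c₀ * K₂ * cb / π + 1) * LΨ)) ^ 2) (4 * cb ^ 2 * K₂ ^ 2 / 1 ^ 2 * LΨ ^ 2) ≤ Bfib →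
      ((m : ℝ) + 1) * (Cw + C) * sectorWidth (d * k') < 2 * π →
      (((m : ℝ) + 1) * C + m * Λ * (⌊(Θ + 5 * sectorWidth (d * k')) / sectorWidth (d * k')⌋₊ : ℕ)) * sectorWidth (d * k') < v₀ →
      ((m : ℝ) + 1) * C * sectorWidth (d * k') < π →
      ∀ Ωe : Fin (m + 1) → Option (SectorLeg (sectorCount (d * k - 1))),
        klLevNormOf L M β μ K (d * k - 1) (m + 1) (klTowerIncr L M β U μ K d k') Ωe ≤
          C₀ ^ (m + 1) * ((27 : ℝ) ^ (levelCount Ωe + 1) * (D₁ ^ (m + 1) + (5 : ℝ) ^ (m + 1) * ((m + 1 : ℕ) ^ 2 * (Bfib * 3 ^ (m - 2)))) *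
              ((2 : ℝ) ^ (d * k - 1 - d * k')) ^ (m - 2) * klTowerBornLev L M β U μ K d k' (m + 1) (levelCount Ωe) +
            (D₂ + 1) * ((m : ℝ) + 2) ^ 3 * 27 ^ (m + 1) * ((2 : ℝ) ^ (d * k - 1 - d * k')) ^ (m - levelCount Ωe) *
              ((2 * ((m : ℝ) + 1) + 1) ^ 2 * (2 * (8 * π * (((m : ℝ) + 1) * C + m * Λ *
                (⌊(Θ + 5 * sectorWidth (d * k')) / sectorWidth (d * k')⌋₊ : ℕ)) / r₀ + 2) *
                (8 * (2 * ((⌊(Θ + 5 * sectorWidth (d * k')) / sectorWidth (d * k')⌋₊ : ℕ) : ℝ) + 1)) ^ m)) *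
              klTowerBornLev L M β U μ K d k' (m + 1) (m + 1)) := by
  obtain ⟨C₀, hC₀, C, hC, D₁, hD₁, Cw, hCw, c₂, cb, K₁, K₂, c₀, c₂', h1, h2, h3, h4, h5, h6, D₂, hD₂, k₀, h⟩ :=
    klLevNormOf_jump_le_narrowWideSplit_klEng_uniform
  refine ⟨C₀, hC₀, C, hC, D₁, hD₁, Cw, hCw, c₂, cb, K₁, K₂, c₀, c₂', h1, h2, h3, h4, h5, h6, D₂, hD₂, k₀, fun R hR2 => ?_⟩
  obtain ⟨c₃, hc₃, U₀, hU₀, Λ, hΛ, r₀, hr₀, v₀, hv₀, h'⟩ := h R hR2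
  refine ⟨c₃, hc₃, U₀, hU₀, Λ, hΛ, r₀, hr₀, v₀, hv₀, ?_⟩
  intro m hm P c hP hc hc6 hcm μ hμ U hU hU9 hUm β hβmin hβc K hK L M _ _ hL3 hM3 d k k' hd hk hk₀ hkN Θ LΨ Bfib hLΨ hΘt hΘδ hΘη hBfib hsmall hsmallv hπC Ωe
  have hβ : 0 < β := KLRegimeSplit.pos_of_klBetaMin_le hβmin
  exact h' m hm P c hP hc hc6 hcm μ hμ U hU hU9 hUm β hβmin hβc K hK L M hL3 hM3 (d * k') (d * k - 1) hk₀ (block_jump_le hd hk) hkN Θ LΨ Bfib hLΨ hΘt hΘδ hΘη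
    hBfib hsmall hsmallv hπC (klTowerIncr L M β U μ K d k') (fun m' X hX => klTowerIncr_momentumConserving β U μ K d k' m' X hX) Ωe
    (klTowerBornLev L M β U μ K d k' (m + 1) (levelCount Ωe)) (klTowerBornLev L M β U μ K d k' (m + 1) (m + 1))
    (klTowerBornLev_nonneg hβ.le U μ K d k' (m + 1) _) (klTowerBornLev_nonneg hβ.le U μ K d k' (m + 1) _)
    (fun Ωe' hlev => by rw [← hlev]; exact klLevNormOf_le_klTowerBornLev β U μ K d k' (m + 1) Ωe')
    (fun Ωf hlev => by
      have hh := klLevNormOf_le_klTowerBornLev (L := L) (M := M) β U μ K d k' (m + 1) Ωf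
      rwa [hlev] at hh)

end Summit.HubbardSuperconductivity.HubbardSuperconductivity.Theorems.EngineV8

end
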